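import Mathlib
import Summits.QuantumFields.YangMills.Theorems.ConvexGribovBodyContinuumLegGivenGapStubCsclKLevelA
import Summits.QuantumFields.YangMills.Theorems.ConvexGribovBodyContinuumLegGivenGapStubCsclReal
import HarnessLib

/-!
# `ContinuumLegGivenGap` (stmt-QuantumFields-15828), line `Sketch`, reshape 18b: `stub_csclKLevel` — uniform Cauchy–Schwarz
# clustering on a late torus (part B: extraction, the algebraic chain and the budget)

Support file for the crux item stmt-QuantumFields-15828 (registered glue stub `stub_csclKLevel` of line `Sketch`, reshape 18b).
At one coupling `β ≥ 0` with the locked volume-uniform lattice gap at `(β, μ, S₁)` on a cofinal set `𝓛` of tori, for every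
tolerance `τ`, complexity bound `Nmax`, shift range `σmax` and `Lmin` there is a torus `L ∈ 𝓛`, `L ≥ Lmin`, on which the centred
reflection pairings of the lattice representatives (box `L`, centring by the torus mean) of ALL test functions supported at times
in `[a, T]` with `≤ Nmax` points satisfy the Osterwalder–Schrader Cauchy–Schwarz clustering bound at rate `μ` up to
`τ ‖F‖_{8n} ‖H‖_{8m}`. Assembly (`klevel_main`): diagonal extraction of a sequence of tori in `𝓛` along which all raw monomial
pairings converge (`klevel_extract`, from `csclReal_diagonal`); ONE tail radius `R` for all `p ≤ Nmax` (`csclLattice_tail`); the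
near (box-`R`, limit-mean-centred) representatives obey the exact limit inequality (`stub_csclLimitCS`) and are uniformly close to
their limits at a late index (`stub_csclKernel`); the full representatives differ from the near ones by far tails and the mean
defect in sup norm (`stub_csclNearFar`), and the budget `klevel_budget` closes the `τ`-bracket (`klevel_chain`, `klevel_endgame`).
Part A (`…StubCsclKLevelA`) holds the elementary bounds. No definitions, no facts; Mathlib + landed tree lemmas only. [folklore]
-/

noncomputable section

namespace Summit.QuantumFields.YangMills.Theorems.ContinuumLegGivenGap

open scoped SchwartzMap ComplexConjugate
open Filter Topology MeasureTheory
open Literature.MathematicalPhysics.QuantumFieldTheory Literature.MathematicalPhysics.QuantumLattice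
  Literature.MathematicalPhysics.AQFT Literature.Probability.LatticeModels
open Summit.QuantumFields.YangMills.Cruxes.ContinuumLimitOnTrajectory.TwoOrbitSynchronisation
  (norm_apply_le_schwartzNorm_mul sum_norm_apply_smul_siteToE_le)

section Main

variable {G : Type} [Group G] [TopologicalSpace G] [IsTopologicalGroup G] [CompactSpace G]
  [MeasurableSpace G] [BorelSpace G]

omit [Group G] [TopologicalSpace G] [IsTopologicalGroup G] [CompactSpace G] [BorelSpace G] in
/-- `configShift 0` is the identity. [folklore] -/
theorem klevel_configShift_zero (U : LGConfig 4 G) : configShift (0 : Site 4) U = U := by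
  funext e; simp

/-- **Extraction at one coupling**: along a strictly increasing sequence of tori inside any cofinal set, all raw monomial pairings
converge (diagonal extraction `csclReal_diagonal` on the countable index of site strings and shifts), and in particular the torus
means of the curvature density converge. [folklore] -/
theorem klevel_extract (r : LatticeRep G) (β : ℝ) (𝓛 : Set ℕ) (h𝓛 : ∀ S : ℕ, ∃ S' : ℕ, S' ∈ 𝓛 ∧ S ≤ S') :
    ∃ Sq : ℕ → ℕ, StrictMono Sq ∧ (∀ j, Sq j ∈ 𝓛) ∧
      (∀ (p q : ℕ) (u : Fin p → Site 4) (v : Fin q → Site 4) (σ : ℕ), ∃ l : ℝ,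
        Tendsto (fun j : ℕ => ∫ U : GaugeConfig 4 (2 * Sq j + 1) G,
          (∏ i : Fin p, r.curvature.F (configShift (-(u i)) (cfgReflect (torusLift (2 * Sq j + 1) U)))) *
            (∏ i : Fin q, r.curvature.F (configShift (-(v i)) (configShift (-(Pi.single 0 ((σ : ℕ) : ℤ))) (torusLift (2 * Sq j + 1) U))))
          ∂(wilsonMeasure r.ρ β)) atTop (𝓝 l)) ∧
      ∃ mi : ℝ, Tendsto (fun j : ℕ => wilsonTorusMean r.ρ β (Sq j) r.curvature.F) atTop (𝓝 mi) := by
  obtain ⟨MP, hMP⟩ := r.curvature.bounded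
  -- diagonal extraction on the countable index of (reflected string, shifted string, shift)
  obtain ⟨Sq, El, hSq, hSq𝓛, hlim⟩ := csclReal_diagonal
    ((Σ p : ℕ, Fin p → Site 4) × (Σ q : ℕ, Fin q → Site 4) × ℕ) 𝓛
    (fun i S => ∫ U : GaugeConfig 4 (2 * S + 1) G,
      (∏ k : Fin i.1.1, r.curvature.F (configShift (-(i.1.2 k)) (cfgReflect (torusLift (2 * S + 1) U)))) *
        (∏ k : Fin i.2.1.1, r.curvature.F (configShift (-(i.2.1.2 k))
          (configShift (-(Pi.single 0 ((i.2.2 : ℕ) : ℤ))) (torusLift (2 * S + 1) U))))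
      ∂(wilsonMeasure r.ρ β)) h𝓛
    (fun i => ⟨MP ^ (i.1.1 + i.2.1.1), fun S => klevel_raw_bound r β S hMP _ _⟩)
  have hraw : ∀ (p q : ℕ) (u : Fin p → Site 4) (v : Fin q → Site 4) (σ : ℕ), ∃ l : ℝ,
      Tendsto (fun j : ℕ => ∫ U : GaugeConfig 4 (2 * Sq j + 1) G,
        (∏ i : Fin p, r.curvature.F (configShift (-(u i)) (cfgReflect (torusLift (2 * Sq j + 1) U)))) *
          (∏ i : Fin q, r.curvature.F (configShift (-(v i)) (configShift (-(Pi.single 0 ((σ : ℕ) : ℤ))) (torusLift (2 * Sq j + 1) U))))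
        ∂(wilsonMeasure r.ρ β)) atTop (𝓝 l) :=
    fun p q u v σ => ⟨El ⟨⟨p, u⟩, ⟨q, v⟩, σ⟩, hlim ⟨⟨p, u⟩, ⟨q, v⟩, σ⟩⟩
  refine ⟨Sq, hSq, hSq𝓛, hraw, ?_⟩
  -- the mean: empty reflected string, the one-point string at the origin, shift zero
  obtain ⟨l, hl⟩ := hraw 0 1 Fin.elim0 (fun _ => 0) 0
  refine ⟨l, hl.congr fun j => ?_⟩
  simp only [Finset.univ_eq_empty, Finset.prod_empty, one_mul, Fin.prod_univ_one, neg_zero, Nat.cast_zero,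
    Pi.single_zero, klevel_configShift_zero]
  rfl

/-- **The right-hand side of the near/far estimate is small**: with the tail radius property at `εR`, the mean closeness `δm`,
`n ≤ Nmax`, `(2MP+1)^n ≤ Bmono` and the uniform coefficient-sum bound `∑‖F(a x⃗)‖ ≤ C* ‖F‖_{8n}`, the bound of
`stub_csclNearFar`.2 is `≤ Bmono (2^{8Nmax} εR + Nmax δm C*) ‖F‖_{8n}`. [folklore] -/
theorem klevel_rhs_bound {n R L Nmax : ℕ} {a mc mc' MP εR δm Bmono Cstar : ℝ}
    (F : SchwartzMap (Fin n → EuclideanSpace ℝ (Fin 4)) ℂ) (hn : n ≤ Nmax) (hMP : 0 ≤ MP)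
    (hBle : (2 * MP + 1) ^ n ≤ Bmono) (hεR : 0 ≤ εR) (hmc : |mc - mc'| ≤ δm)
    (htail : ∀ T : Finset (Fin n → Site 4), (∀ y ∈ T, ∃ i, y i ∉ box 4 R) →
      ∑ y ∈ T, ((1 + ‖fun i => a • siteToE (y i)‖) ^ (8 * n))⁻¹ ≤ εR)
    (hsum : ∑ x : Fin n → ↥(box 4 L), ‖F (fun i => a • siteToE (↑(x i) : Site 4))‖ ≤ Cstar * schwartzNorm (8 * n) F) :
    (2 * MP + 1) ^ n * (∑ x : Fin n → ↥(box 4 L),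
        if (∀ i, (↑(x i) : Site 4) ∈ box 4 R) then 0 else ‖F (fun i => a • siteToE ↑(x i))‖) +
      n * (2 * MP + 1) ^ n * |mc - mc'| * ∑ x : Fin n → ↥(box 4 L), ‖F (fun i => a • siteToE ↑(x i))‖ ≤
    Bmono * (2 ^ (8 * Nmax) * εR + Nmax * δm * Cstar) * schwartzNorm (8 * n) F := by
  have hf0 : 0 ≤ schwartzNorm (8 * n) F := schwartzNorm_nonneg _ _
  have hB0 : 0 ≤ Bmono := le_trans (by positivity) hBle
  have hδm : 0 ≤ δm := (abs_nonneg _).trans hmc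
  have hC : 0 ≤ Cstar * schwartzNorm (8 * n) F := (Finset.sum_nonneg fun x _ => norm_nonneg _).trans hsum
  have hfar := klevel_far_sum_le (L := L) (a := a) F htail
  have h2n : (2:ℝ) ^ (8 * n) ≤ 2 ^ (8 * Nmax) := pow_le_pow_right₀ (by norm_num) (by omega)
  have hA : (2 * MP + 1) ^ n * (∑ x : Fin n → ↥(box 4 L), if (∀ i, (↑(x i) : Site 4) ∈ box 4 R) then (0:ℝ)
      else ‖F (fun i => a • siteToE ↑(x i))‖) ≤ Bmono * (2 ^ (8 * Nmax) * εR) * schwartzNorm (8 * n) F := by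
    calc _ ≤ Bmono * (2 ^ (8 * n) * schwartzNorm (8 * n) F * εR) :=
          mul_le_mul hBle hfar (Finset.sum_nonneg fun x _ => by split_ifs <;> positivity) hB0
      _ ≤ Bmono * (2 ^ (8 * Nmax) * schwartzNorm (8 * n) F * εR) := by
          refine mul_le_mul_of_nonneg_left ?_ hB0
          exact mul_le_mul_of_nonneg_right (mul_le_mul_of_nonneg_right h2n hf0) hεR
      _ = Bmono * (2 ^ (8 * Nmax) * εR) * schwartzNorm (8 * n) F := by ring
  have hB' : (n : ℝ) * (2 * MP + 1) ^ n * |mc - mc'| *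
      (∑ x : Fin n → ↥(box 4 L), ‖F (fun i => a • siteToE ↑(x i))‖) ≤
        Bmono * (Nmax * δm * Cstar) * schwartzNorm (8 * n) F := by
    have hn' : (n : ℝ) ≤ Nmax := by exact_mod_cast hn
    calc _ ≤ (Nmax : ℝ) * Bmono * δm * (Cstar * schwartzNorm (8 * n) F) :=
          mul_le_mul (mul_le_mul (mul_le_mul hn' hBle (by positivity) (Nat.cast_nonneg _)) hmc
            (abs_nonneg _) (by positivity)) hsum (Finset.sum_nonneg fun x _ => norm_nonneg _) (by positivity)
      _ = Bmono * (Nmax * δm * Cstar) * schwartzNorm (8 * n) F := by ring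
  calc _ ≤ Bmono * (2 ^ (8 * Nmax) * εR) * schwartzNorm (8 * n) F + Bmono * (Nmax * δm * Cstar) * schwartzNorm (8 * n) F :=
        add_le_add hA hB'
    _ = _ := by ring

/-- **The chain at the chosen torus** (pure algebra): perturbation (`h1–h3`), kernel uniformity (`h4–h6`), the limit inequality (`h7`)
and the variance majorisation (`h9`) give the endgame's conclusion. [folklore] -/
theorem klevel_chain {pXY pX'Y' qXX qX'X' qYY qY'Y' lσ lXX lYY : ℂ}
    {PX PY vX vY e δB NF NH ηX ηY BX BY : ℝ}
    (h1 : ‖pXY - pX'Y'‖ ≤ 2 * (ηX * BY + BX * ηY)) (h2 : ‖qXX - qX'X'‖ ≤ 2 * (ηX * BX + BX * ηX))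
    (h3 : ‖qYY - qY'Y'‖ ≤ 2 * (ηY * BY + BY * ηY)) (h4 : ‖pX'Y' - lσ‖ ≤ δB * NF * NH)
    (h5 : ‖qX'X' - lXX‖ ≤ δB * NF * NF) (h6 : ‖qY'Y' - lYY‖ ≤ δB * NH * NH)
    (h7 : ‖lσ‖ ≤ e * Real.sqrt vX * Real.sqrt vY) (he0 : 0 ≤ e) (he1 : e ≤ 1)
    (hvX : vX = lXX.re) (hvY : vY = lYY.re) (hqX : qXX.re ≤ PX) (hqY : qYY.re ≤ PY)
    (hδB : 0 ≤ δB) (hNF : 0 ≤ NF) (hNH : 0 ≤ NH) (hηX : 0 ≤ ηX) (hηY : 0 ≤ ηY) (hBX : 0 ≤ BX) (hBY : 0 ≤ BY) :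
    ‖pXY‖ ≤ e * Real.sqrt PX * Real.sqrt PY +
      (δB * NF * NH + 2 * (ηX * BY + BX * ηY) + Real.sqrt (4 * ηX * BX + δB * NF * NF) * Real.sqrt PY +
        Real.sqrt PX * Real.sqrt (4 * ηY * BY + δB * NH * NH) +
        Real.sqrt (4 * ηX * BX + δB * NF * NF) * Real.sqrt (4 * ηY * BY + δB * NH * NH)) := by
  have hre : ∀ z w : ℂ, z.re ≤ w.re + ‖z - w‖ := fun z w => by
    have := Complex.abs_re_le_norm (z - w)
    rw [Complex.sub_re] at this
    linarith [le_abs_self (z.re - w.re)]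
  have hc : ‖pXY‖ ≤ ‖lσ‖ + δB * NF * NH + 2 * (ηX * BY + BX * ηY) := by
    have e1 : ‖pXY‖ ≤ ‖pX'Y'‖ + ‖pXY - pX'Y'‖ := norm_le_insert' _ _
    have e2 : ‖pX'Y'‖ ≤ ‖lσ‖ + ‖pX'Y' - lσ‖ := norm_le_insert' _ _
    linarith
  have hκX : vX ≤ PX + (4 * ηX * BX + δB * NF * NF) := by
    rw [hvX]
    linarith [hre lXX qX'X', hre qX'X' qXX, norm_sub_rev qX'X' lXX, norm_sub_rev qXX qX'X']
  have hκY : vY ≤ PY + (4 * ηY * BY + δB * NH * NH) := by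
    rw [hvY]
    linarith [hre lYY qY'Y', hre qY'Y' qYY, norm_sub_rev qY'Y' lYY, norm_sub_rev qYY qY'Y']
  exact klevel_endgame hc h7 he0 he1 hκX hκY (by positivity) (by positivity)
set_option maxHeartbeats 400000 in
/-- **The budget**: with the smallness parameters of the k-level theorem, the endgame's bracket is `≤ τ ‖F‖ ‖H‖`. [folklore] -/
theorem klevel_budget {θ τ Bs Cs ηs ηtar δB f h NF NH PX PY : ℝ} (hθ0 : 0 < θ) (hθ1 : θ ≤ 1)
    (hθτ : θ * (15 + 6 * Bs) ≤ τ) (hBs : 0 ≤ Bs) (hCs : 0 ≤ Cs) (hf : 0 ≤ f) (hh : 0 ≤ h)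
    (hδB : δB = (θ / (Cs + 1)) ^ 2) (hηtar : ηtar = θ ^ 2 / (Bs + 1)) (hηs : ηs ≤ ηtar)
    (hNF : NF ≤ Cs * f) (hNH : NH ≤ Cs * h) (hNF0 : 0 ≤ NF) (hNH0 : 0 ≤ NH)
    (hPX : PX ≤ (Bs * f) ^ 2) (hPY : PY ≤ (Bs * h) ^ 2) :
    δB * NF * NH + 2 * (ηs * f * (Bs * h) + Bs * f * (ηs * h)) +
        Real.sqrt (4 * (ηs * f) * (Bs * f) + δB * NF * NF) * Real.sqrt PY +
        Real.sqrt PX * Real.sqrt (4 * (ηs * h) * (Bs * h) + δB * NH * NH) +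
        Real.sqrt (4 * (ηs * f) * (Bs * f) + δB * NF * NF) * Real.sqrt (4 * (ηs * h) * (Bs * h) + δB * NH * NH) ≤
      τ * f * h := by
  have hθ2 : θ ^ 2 ≤ θ := by nlinarith
  have hδB0 : 0 ≤ δB := by rw [hδB]; positivity
  -- `δB Cs² ≤ θ²` and `ηs Bs ≤ θ²`
  have hdC : δB * Cs * Cs ≤ θ ^ 2 := by
    rw [hδB, div_pow]
    have hpos : 0 < (Cs + 1) ^ 2 := by positivity
    rw [div_mul_eq_mul_div, div_mul_eq_mul_div, div_le_iff₀ hpos]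
    nlinarith [sq_nonneg θ, hCs]
  have hηB : ηs * Bs ≤ θ ^ 2 := by
    have h1 : ηtar * Bs ≤ θ ^ 2 := by
      rw [hηtar, div_mul_eq_mul_div, div_le_iff₀ (by linarith)]
      nlinarith [sq_nonneg θ]
    exact (mul_le_mul_of_nonneg_right hηs hBs).trans h1
  -- `κ ≤ 5 θ² f²`
  have hκX : 4 * (ηs * f) * (Bs * f) + δB * NF * NF ≤ 5 * θ ^ 2 * f ^ 2 := by
    have e1 : 4 * (ηs * f) * (Bs * f) = 4 * (ηs * Bs) * f ^ 2 := by ring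
    have e2 : δB * NF * NF ≤ δB * (Cs * f) * (Cs * f) :=
      mul_le_mul (mul_le_mul_of_nonneg_left hNF hδB0) hNF hNF0 (mul_nonneg hδB0 (hCs.trans' le_rfl |> fun _ => by positivity))
    nlinarith [mul_le_mul_of_nonneg_right hηB (sq_nonneg f), mul_le_mul_of_nonneg_right hdC (sq_nonneg f)]
  have hκY : 4 * (ηs * h) * (Bs * h) + δB * NH * NH ≤ 5 * θ ^ 2 * h ^ 2 := by
    have e2 : δB * NH * NH ≤ δB * (Cs * h) * (Cs * h) :=
      mul_le_mul (mul_le_mul_of_nonneg_left hNH hδB0) hNH hNH0 (by positivity)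
    nlinarith [mul_le_mul_of_nonneg_right hηB (sq_nonneg h), mul_le_mul_of_nonneg_right hdC (sq_nonneg h)]
  have hsκX : Real.sqrt (4 * (ηs * f) * (Bs * f) + δB * NF * NF) ≤ 3 * θ * f := by
    rw [Real.sqrt_le_left (by positivity)]
    nlinarith [sq_nonneg (θ * f)]
  have hsκY : Real.sqrt (4 * (ηs * h) * (Bs * h) + δB * NH * NH) ≤ 3 * θ * h := by
    rw [Real.sqrt_le_left (by positivity)]
    nlinarith [sq_nonneg (θ * h)]
  have hsPX : Real.sqrt PX ≤ Bs * f := by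
    rw [Real.sqrt_le_left (by positivity)]; exact hPX
  have hsPY : Real.sqrt PY ≤ Bs * h := by
    rw [Real.sqrt_le_left (by positivity)]; exact hPY
  -- the five terms
  have t1 : δB * NF * NH ≤ θ ^ 2 * f * h := by
    calc δB * NF * NH ≤ δB * (Cs * f) * (Cs * h) :=
          mul_le_mul (mul_le_mul_of_nonneg_left hNF hδB0) hNH hNH0 (by positivity)
      _ = (δB * Cs * Cs) * (f * h) := by ring
      _ ≤ θ ^ 2 * (f * h) := mul_le_mul_of_nonneg_right hdC (by positivity)
      _ = θ ^ 2 * f * h := by ring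
  have t2 : 2 * (ηs * f * (Bs * h) + Bs * f * (ηs * h)) ≤ 4 * θ ^ 2 * f * h := by
    have : 2 * (ηs * f * (Bs * h) + Bs * f * (ηs * h)) = 4 * (ηs * Bs) * (f * h) := by ring
    rw [this]
    nlinarith [mul_le_mul_of_nonneg_right hηB (mul_nonneg hf hh)]
  have t3 : Real.sqrt (4 * (ηs * f) * (Bs * f) + δB * NF * NF) * Real.sqrt PY ≤ 3 * θ * f * (Bs * h) :=
    mul_le_mul hsκX hsPY (Real.sqrt_nonneg _) (by positivity)
  have t4 : Real.sqrt PX * Real.sqrt (4 * (ηs * h) * (Bs * h) + δB * NH * NH) ≤ Bs * f * (3 * θ * h) :=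
    mul_le_mul hsPX hsκY (Real.sqrt_nonneg _) (by positivity)
  have t5 : Real.sqrt (4 * (ηs * f) * (Bs * f) + δB * NF * NF) *
      Real.sqrt (4 * (ηs * h) * (Bs * h) + δB * NH * NH) ≤ 3 * θ * f * (3 * θ * h) :=
    mul_le_mul hsκX hsκY (Real.sqrt_nonneg _) (by positivity)
  have hfh : 0 ≤ f * h := mul_nonneg hf hh
  have key : θ ^ 2 * f * h + 4 * θ ^ 2 * f * h + 3 * θ * f * (Bs * h) + Bs * f * (3 * θ * h) +
      3 * θ * f * (3 * θ * h) ≤ τ * f * h := by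
    have e : θ ^ 2 * f * h + 4 * θ ^ 2 * f * h + 3 * θ * f * (Bs * h) + Bs * f * (3 * θ * h) +
        3 * θ * f * (3 * θ * h) = (14 * θ ^ 2 + 6 * Bs * θ) * (f * h) := by ring
    rw [e, show τ * f * h = τ * (f * h) by ring]
    refine mul_le_mul_of_nonneg_right ?_ hfh
    nlinarith [mul_nonneg hBs hθ0.le]
  linarith

end Main

/-- Registered anchor of this support file (part B of `stub_csclKLevel`): the smallness parameter `θ = min 1 x` of the
budget is positive and at most one. [folklore] -/
theorem cscl_anchor_klevelB : ∀ (x : ℝ), 0 < x → 0 < min 1 x ∧ min 1 x ≤ 1 :=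
  fun _ hx => ⟨lt_min one_pos hx, min_le_left _ _⟩

end Summit.QuantumFields.YangMills.Theorems.ContinuumLegGivenGap

end
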